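import Mathlib.LinearAlgebra.Lagrange
import Mathlib.Analysis.Polynomial.MahlerMeasure
import HarnessLib

/-!
# Archimedean bounds for the integral shape lemma

Topic `Literature/RingTheory/ZeroDimensional`, companion of `IntegralShapeLemma.lean`: the sizes
of the integer `D = ∏_{z ∈ V} μ'(y_z)` and of the coefficients of the integral interpolant
`W = ∑_{z ∈ V} (c t_z)(∏_{z' ≠ z} μ'(y_{z'})) ∏_{z' ≠ z} (T - y_{z'})` of that file, in terms of
`N = |V|`, a bound `Y ≥ 1` for the nodes `|y_z|` and a bound `T` for `|c t_z|`:

* `norm_prod_eval_derivative_nodal_le` — `|D| ≤ (2Y)^{N(N-1)}`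
  (each `μ'(y_z) = ∏_{z' ≠ z} (y_z - y_{z'})` has absolute value `≤ (2Y)^{N-1}`);
* `norm_coeff_interpolant_le` — `|coeff_n W| ≤ N · T · (2Y)^{N(N-1)}` (the coefficients of
  `∏_{z' ≠ z}(T - y_{z'})` are bounded through Mathlib's Mahler-measure estimate
  `‖coeff_n p‖ ≤ binom(deg p, n) M(p)`, `M = ∏ max(1, |y_{z'}|) ≤ Y^{N-1}`).

Only the triangle inequality is used; these are the estimates that turn bounds for the POINTS of a
zero-dimensional variety into bounds for the heights of its integer geometric resolution
(Krick–Pardo 1996, Prop. 27 with Bürgisser 2000 TCS, Lemma 2.4 / p. 82,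
"`max{log λ, log wt(v_i)} = d^{O(n)} log w`").

## References

* T. Krick, L. M. Pardo, Progr. Math. 143 (1996), Prop. 27. [KrickPardo1996]
* P. Bürgisser, TCS 235 (2000), proof of Thm. 4.5, p. 82. [Burgisser2000TCS]
-/

noncomputable section

open Polynomial Lagrange Finset

namespace Literature.RingTheory.ZeroDimensional

variable {α : Type*}

/-- `|∏_{z' ∈ s} (x - y_{z'})| ≤ (2Y)^{#s}` when `|x|, |y_{z'}| ≤ Y`. [folklore] -/
theorem norm_prod_sub_le (s : Finset α) (y : α → ℂ) {x : ℂ} {Y : ℝ} (hx : ‖x‖ ≤ Y)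
    (hy : ∀ z ∈ s, ‖y z‖ ≤ Y) : ‖∏ z ∈ s, (x - y z)‖ ≤ (2 * Y) ^ s.card := by
  rw [norm_prod, ← prod_const]
  refine prod_le_prod (fun _ _ => norm_nonneg _) fun z hz => ?_
  calc ‖x - y z‖ ≤ ‖x‖ + ‖y z‖ := norm_sub_le _ _
    _ ≤ Y + Y := add_le_add hx (hy z hz)
    _ = 2 * Y := by ring

/-- The derivative of the node polynomial at a node: `|μ'(y_z)| ≤ (2Y)^{N-1}`. [folklore] -/
theorem norm_eval_derivative_nodal_le [DecidableEq α] (V : Finset α) (y : α → ℂ) {Y : ℝ}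
    (hy : ∀ z ∈ V, ‖y z‖ ≤ Y) {z : α} (hz : z ∈ V) :
    ‖(derivative (nodal V y)).eval (y z)‖ ≤ (2 * Y) ^ (V.card - 1) := by
  rw [eval_nodal_derivative_eval_node_eq hz, eval_nodal, ← card_erase_of_mem hz]
  exact norm_prod_sub_le _ _ (hy z hz) fun z' hz' => hy z' (mem_of_mem_erase hz')

/-- The coefficients of the node polynomial: `|coeff_n ∏_{z ∈ s}(X - y_z)| ≤ 2^{#s} Y^{#s}` for
`|y_z| ≤ Y`, `Y ≥ 1` (through the Mahler measure `∏ max(1, |y_z|)`). [folklore] -/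
theorem norm_coeff_nodal_le (s : Finset α) (y : α → ℂ) {Y : ℝ} (hY : 1 ≤ Y)
    (hy : ∀ z ∈ s, ‖y z‖ ≤ Y) (n : ℕ) :
    ‖(nodal s y).coeff n‖ ≤ (2 * Y) ^ s.card := by
  have hM : (nodal s y).mahlerMeasure ≤ Y ^ s.card := by
    rw [mahlerMeasure_eq_leadingCoeff_mul_prod_roots, (nodal_monic (s := s) (v := y)).leadingCoeff,
      norm_one, one_mul]
    have hroots : (nodal s y).roots = s.val.map y := by
      have : nodal s y = ((s.val.map y).map fun a => X - C a).prod := by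
        rw [nodal, Finset.prod_eq_multiset_prod, Multiset.map_map]; rfl
      rw [this, roots_multiset_prod_X_sub_C]
    rw [hroots, Multiset.map_map, ← Finset.prod_eq_multiset_prod, ← prod_const]
    refine prod_le_prod (fun _ _ => le_trans zero_le_one (le_max_left _ _)) fun z hz => ?_
    exact max_le hY (hy z hz)
  calc ‖(nodal s y).coeff n‖ ≤ ((nodal s y).natDegree.choose n) * (nodal s y).mahlerMeasure :=
        norm_coeff_le_choose_mul_mahlerMeasure n _
    _ ≤ 2 ^ s.card * Y ^ s.card := by
        refine mul_le_mul ?_ hM (mahlerMeasure_nonneg _) (by positivity)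
        rw [natDegree_nodal]
        exact_mod_cast (Nat.choose_le_two_pow _ _)
    _ = (2 * Y) ^ s.card := by rw [mul_pow]

/-- **Bound for `D = ∏_z μ'(y_z)`**: `|D| ≤ (2Y)^{N(N-1)}`. [folklore] -/
theorem norm_prod_eval_derivative_nodal_le [DecidableEq α] (V : Finset α) (y : α → ℂ) {Y : ℝ}
    (hy : ∀ z ∈ V, ‖y z‖ ≤ Y) :
    ‖∏ z ∈ V, (derivative (nodal V y)).eval (y z)‖ ≤ (2 * Y) ^ (V.card * (V.card - 1)) := by
  rw [norm_prod, show V.card * (V.card - 1) = (V.card - 1) * V.card from Nat.mul_comm _ _,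
    pow_mul, ← prod_const]
  exact prod_le_prod (fun _ _ => norm_nonneg _) fun z hz => norm_eval_derivative_nodal_le V y hy hz

/-- **Bound for the coefficients of the integral interpolant**
`W = ∑_z (c t_z) (∏_{z' ≠ z} μ'(y_{z'})) ∏_{z' ≠ z} (X - y_{z'})`:
`|coeff_n W| ≤ N · T · (2Y)^{N(N-1)}` when `|y_z| ≤ Y` (`Y ≥ 1`) and `|c t_z| ≤ T`. [folklore] -/
theorem norm_coeff_interpolant_le [DecidableEq α] (V : Finset α) (y : α → ℂ) (c : ℕ)
    (t : α → ℂ) {Y T : ℝ}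
    (hY : 1 ≤ Y) (hT : 0 ≤ T) (hy : ∀ z ∈ V, ‖y z‖ ≤ Y) (ht : ∀ z ∈ V, ‖(c : ℂ) * t z‖ ≤ T)
    (n : ℕ) :
    ‖(∑ z ∈ V, C ((c : ℂ) * t z * ∏ z' ∈ V.erase z, (derivative (nodal V y)).eval (y z')) *
        nodal (V.erase z) y).coeff n‖ ≤ V.card * T * (2 * Y) ^ (V.card * (V.card - 1)) := by
  have h2Y : 0 ≤ 2 * Y := by linarith
  rw [finsetSum_coeff]
  calc ‖∑ z ∈ V, (C ((c : ℂ) * t z * ∏ z' ∈ V.erase z, (derivative (nodal V y)).eval (y z')) *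
          nodal (V.erase z) y).coeff n‖
      ≤ ∑ z ∈ V, ‖(C ((c : ℂ) * t z * ∏ z' ∈ V.erase z, (derivative (nodal V y)).eval (y z')) *
          nodal (V.erase z) y).coeff n‖ := norm_sum_le _ _
    _ ≤ ∑ _z ∈ V, T * (2 * Y) ^ (V.card * (V.card - 1)) := by
        refine sum_le_sum fun z hz => ?_
        rw [coeff_C_mul, norm_mul, norm_mul, norm_prod]
        have hA : ∏ z' ∈ V.erase z, ‖(derivative (nodal V y)).eval (y z')‖ ≤
            ((2 * Y) ^ (V.card - 1)) ^ (V.card - 1) := by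
          rw [← card_erase_of_mem hz, ← prod_const]
          refine prod_le_prod (fun _ _ => norm_nonneg _) fun z' hz' => ?_
          rw [card_erase_of_mem hz]
          exact norm_eval_derivative_nodal_le V y hy (mem_of_mem_erase hz')
        have hQ : ‖(nodal (V.erase z) y).coeff n‖ ≤ (2 * Y) ^ (V.card - 1) := by
          rw [← card_erase_of_mem hz]
          exact norm_coeff_nodal_le _ _ hY (fun z' hz' => hy z' (mem_of_mem_erase hz')) n
        calc ‖(c : ℂ) * t z‖ * (∏ z' ∈ V.erase z, ‖(derivative (nodal V y)).eval (y z')‖) *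
              ‖(nodal (V.erase z) y).coeff n‖
            ≤ T * ((2 * Y) ^ (V.card - 1)) ^ (V.card - 1) * (2 * Y) ^ (V.card - 1) := by
              refine mul_le_mul (mul_le_mul (ht z hz) hA (prod_nonneg fun _ _ => norm_nonneg _) hT)
                hQ (norm_nonneg _) (mul_nonneg hT (by positivity))
          _ = T * (2 * Y) ^ (V.card * (V.card - 1)) := by
              rw [mul_assoc, ← pow_mul, ← pow_add]
              congr 2
              rcases Nat.eq_zero_or_pos V.card with h0 | hpos
              · rw [h0]
              · obtain ⟨m, hm⟩ : ∃ m, V.card = m + 1 := ⟨_, (Nat.sub_add_cancel hpos).symm⟩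
                rw [hm, Nat.add_sub_cancel]
                ring
    _ = V.card * T * (2 * Y) ^ (V.card * (V.card - 1)) := by
        rw [sum_const, nsmul_eq_mul]; ring

end Literature.RingTheory.ZeroDimensional

end
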